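import Summits.QuantumAdvantage.QuantumAdvantage.Theorems.InnerDegreeLawsB

set_option linter.dupNamespace false

/-!
# LIVENESS SEPARATION, part G (lens 4, g28 cycle 4) — merging two co-live registers

Blocker `X = AbsorptionDial.NoPerfectPolyOdd` (item 28487); rung-2 piece `TwoQuadNoPerfectOdd`, ENDS configuration (NODE-g28 §5e, claim T2).
When two registers `g₀ ≠ g₁` are live at exactly the same inputs (for the two END cuts `0`, `n` this is `n ≡ c (mod 3)`, part E `coLive_ends`),
the strategy `merge y g₀ g₁` — register `g₀` fires iff exactly one of `y g₀`, `y g₁` fires, register `g₁` silenced, all other registers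
unchanged — has the SAME win bit at every such input (`ringWinU_merge`), hence is perfect iff `y` is (`perfect_merge_iff`).  In the ends
configuration of `TwoQuadNoPerfectOdd` the merged strategy has ONE exceptional register (cut `0`, flat walk) reading `2k` linear forms and TWO
quadratic forms, every other register `k`-form: the tree's LAW R (`rectRank_le_of_perfect`) applies to it verbatim, and T2 is the one-register /
two-quadratics version of (c0) (NODE-g28 §5e).  Pure bookkeeping over `InnerDegreeDial.silence` / `ringWinU_silence`; no arithmetic.
-/

open Finset
open Summit.QuantumAdvantage.AdviceFreeQNC0
open Summit.QuantumAdvantage.QuantumAdvantage.Theorems.InnerDegreeDial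

namespace Summit.QuantumAdvantage.QuantumAdvantage.Theorems.LivenessSeparation

variable {n : ℕ}

/-- merge register `g₁` into register `g₀`: `g₀` fires iff exactly one of the two fired, `g₁` is silenced, the rest is unchanged -/
def merge (y : Fin (n + 1) → (Fin n → Bool) → Bool) (g₀ g₁ : Fin (n + 1)) : Fin (n + 1) → (Fin n → Bool) → Bool :=
  Function.update (silence y g₁) g₀ (fun u => xor (y g₀ u) (y g₁ u))

/-- the merged register -/
theorem merge_fst (y : Fin (n + 1) → (Fin n → Bool) → Bool) (g₀ g₁ : Fin (n + 1)) (u : Fin n → Bool) :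
    merge y g₀ g₁ g₀ u = xor (y g₀ u) (y g₁ u) := by
  simp [merge]

/-- the silenced register -/
theorem merge_snd (y : Fin (n + 1) → (Fin n → Bool) → Bool) {g₀ g₁ : Fin (n + 1)} (hg : g₀ ≠ g₁) (u : Fin n → Bool) :
    merge y g₀ g₁ g₁ u = false := by
  rw [merge, Function.update_of_ne hg.symm, silence, Function.update_self]

/-- every other register is unchanged -/
theorem merge_of_ne (y : Fin (n + 1) → (Fin n → Bool) → Bool) {g₀ g₁ g : Fin (n + 1)} (h₀ : g ≠ g₀) (h₁ : g ≠ g₁)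
    (u : Fin n → Bool) : merge y g₀ g₁ g u = y g u := by
  rw [merge, Function.update_of_ne h₀, silence, Function.update_of_ne h₁]

/-- silencing the merged register leaves the doubly silenced strategy -/
theorem silence_merge (y : Fin (n + 1) → (Fin n → Bool) → Bool) (g₀ g₁ : Fin (n + 1)) :
    silence (merge y g₀ g₁) g₀ = silence (silence y g₁) g₀ := by
  unfold merge silence
  rw [Function.update_idem]

/-- **MERGE LAW (pointwise).**  At an input where `g₀` and `g₁` are live together or dead together, merging does not change the win bit. -/
theorem ringWinU_merge (c : ℕ) (y : Fin (n + 1) → (Fin n → Bool) → Bool) {g₀ g₁ : Fin (n + 1)} (hg : g₀ ≠ g₁)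
    (u : Fin n → Bool) (hco : liveCut c u g₀ = liveCut c u g₁) :
    ringWinU c (merge y g₀ g₁) u = ringWinU c y u := by
  have h1 := ringWinU_silence c y g₁ u
  have h2 := ringWinU_silence c (silence y g₁) g₀ u
  have h3 := ringWinU_silence c (merge y g₀ g₁) g₀ u
  rw [silence_merge, merge_fst] at h3
  have hs : silence y g₁ g₀ u = y g₀ u := by rw [silence, Function.update_of_ne hg]
  rw [hs] at h2
  rw [h3, h1, h2, hco]
  cases ringWinU c (silence (silence y g₁) g₀) u <;> cases y g₀ u <;> cases y g₁ u <;> cases liveCut c u g₁ <;> rfl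

/-- **MERGE LAW.**  Two registers co-live at every input can be merged: the merged strategy is perfect iff the original one is. -/
theorem perfect_merge_iff (c : ℕ) (y : Fin (n + 1) → (Fin n → Bool) → Bool) {g₀ g₁ : Fin (n + 1)} (hg : g₀ ≠ g₁)
    (hco : ∀ u, liveCut c u g₀ = liveCut c u g₁) :
    (∀ u, ringWinU c (merge y g₀ g₁) u = true) ↔ (∀ u, ringWinU c y u = true) := by
  refine forall_congr' fun u => ?_
  rw [ringWinU_merge c y hg u (hco u)]

/-- contrapositive form used by T2: a losing input of the merged strategy is a losing input of the original -/
theorem loss_of_merge_loss (c : ℕ) (y : Fin (n + 1) → (Fin n → Bool) → Bool) {g₀ g₁ : Fin (n + 1)} (hg : g₀ ≠ g₁)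
    (hco : ∀ u, liveCut c u g₀ = liveCut c u g₁) (h : ∃ u, ringWinU c (merge y g₀ g₁) u = false) :
    ∃ u, ringWinU c y u = false := by
  obtain ⟨u, hu⟩ := h
  exact ⟨u, by rw [← ringWinU_merge c y hg u (hco u)]; exact hu⟩

/-! ### Sanity -/

/-- merging is the Boolean identity `A ⊕ (a∧L) ⊕ (b∧L) = A ⊕ ((a ⊕ b)∧L)` -/
example : ∀ A a b L : Bool, xor (xor A (a && L)) (b && L) = xor A ((xor a b) && L) := by decide

end Summit.QuantumAdvantage.QuantumAdvantage.Theorems.LivenessSeparation
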